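import Literature.AnabelianGeometry.EtaleTheta.Discharge.Sec5Prop53ToyChainGeometry
import Mathlib.Data.Int.Interval
import HarnessLib

/-!
# [EtTh] §5, Prop. 5.3 (v): the p.326–327 ADJACENCY CRITERION binder (`hAdj`) of the order-coordinate instance form
# `preservesNcspLabels_of_orders` HOLDS at a PERFECT toy `Φ(A_⊚)` — non-vacuity certificate for row F-0563

Mochizuki, *The étale theta function and its Frobenioid-theoretic manifestations*, Publ. RIMS **45** (2009), §5, Prop. 5.3 (v)
p. 325 (PDF p. 99), proof pp. 326–327 (PDF pp. 100–101): "if `a ∈ 𝔭`, `b ∈ 𝔮` correspond via the natural isomorphisms of (ii),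
then `𝔭, 𝔮` are adjacent (respectively, not adjacent) if and only if every cuspidally minimal `c ∈ Φ(A_⊚)^gp` which is linearly
equivalent to `a + b` has support of cardinality 4 (respectively, 5 or 6)" [cite: MochizukiEtTh2009, Prop 5.3 (v) p.325 (PDF
p.99); proof p.327 (PDF p.101)]; §1 p. 240 (PDF p. 14) (degrees on the chain).  Cell abc-iut, block F, seat abc-iut-f-127
(gen 2).  PROOF-ONLY certificate over `Sec5Prop53ToyChainGeometry.lean` (this seat) on abc-iut-f-009's toy (`Sec5Prop53Toy.lean`):
no `def`, no instance, nothing landed is edited.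

WHY.  abc-iut-f-128's instance form `preservesNcspLabels_of_orders` (`Sec5Prop53LabelsOrders.lean`, p438690) carries print's
adjacency criterion as the binder `hAdj` (first clause of L6-d1's `AdjacencyCriterion'`, read over `factor`/`P`); it had no
satisfiability certificate.  Here, at the toy datum `Φ(A_⊚) = ⊕_{ℤ ⊔ ℤ} ℚ_{≥0}` (perfect — the forms of record are vacuous
there), with `P :=` the DEGREE-ZERO classes of the chain, **`hAdj` HOLDS** (`adjacencyCriterion_toy`), by the computation
print alludes to: for `a = α·C_i`, `b = α·C_{i'}` (its image under the natural isomorphism), a cuspidal `c ~ a + b` has cusp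
coefficients `α·(C_i + C_{i'}) · C_k` (`lap i k := C_i · C_k`: `−2`, `1`, `0`), whose support is `{i−1, i, i+1, i+2}` — cardinality 4 — when
`i' = i + 1`, and has cardinality `≥ 5` (`5` for `|i − i'| = 2`, `6` beyond) otherwise; the cuspidal representative
`c₀ = α(cusp_{i−1} + cusp_{i+1} + cusp_{i'−1} + cusp_{i'+1}) − 2α(cusp_i + cusp_{i'})` exists, is unique in its class
(rigidity) hence cuspidally minimal — so the "only if" direction has content too.  With (i) on primes, (ii) for the chain
translations (`preservesNcspComponentIsos_shift`), `hψo`, `hP`: **`preservesNcspLabels_shift_viaOrders`** — (v) at the toy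
derived THROUGH the order form with every binder discharged; ∃-form `adjacency_binders_toy`.

HONEST FRAMING: a toy certificate about OUR binders; nothing about [EtTh] §5's tempered Frobenioid or [IUTchIII] Cor. 3.12;
no side taken; typed ≠ proved.
-/

namespace Literature.AnabelianGeometry.EtaleTheta

namespace FrobenioidThetaDivisors

namespace Prop53Toy

open CategoryTheory
open Literature.AlgebraicGeometry.Frobenioids
open ConstantMultiple ConstantMultiple.Cor512Toy

/-! ### The intersection numbers of the chain: the profile `k ↦ C_i · C_k` -/

/-- `lap i k := C_i · C_k` on the chain of projective lines: `−2` for `k = i`, `1` for `k = i ± 1`, `0` otherwise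
([EtTh] §1 p.240 (PDF p.14); the special fibre `Σ_k C_k` is principal, so `C_i² = −(C_{i−1} + C_{i+1}) · C_i = −2`).
[cite: MochizukiEtTh2009, §1 p.240 (PDF p.14)] -/
def lap (i k : ℤ) : ℚ := if k = i then -2 else if k = i - 1 ∨ k = i + 1 then 1 else 0

/-- The second difference of `α·δ_i` is `α·lap i`. [cite: MochizukiEtTh2009, §1 p.240 (PDF p.14)] -/
theorem lap_eq (i k : ℤ) (α : ℚ) :
    (if k - 1 = i then α else 0) - 2 * (if k = i then α else 0) + (if k + 1 = i then α else 0) = α * lap i k := by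
  unfold lap
  split_ifs <;> first | (exfalso; omega) | ring

/-- The cusp element `α·(cusp_{i−1} + cusp_{i+1} − 2·cusp_i)` has profile `α·lap i`. [cite: MochizukiEtTh2009, §1 p.240 (PDF p.14)] -/
theorem lap_eq' (i k : ℤ) (α : ℚ) :
    (if k = i - 1 then α else 0) + (if k = i + 1 then α else 0) - (if k = i then 2 * α else 0) = α * lap i k := by
  unfold lap
  split_ifs <;> first | (exfalso; omega) | ring

/-- `lap i` is supported on `[i − 1, i + 1]`. [cite: MochizukiEtTh2009, §1 p.240 (PDF p.14)] -/
theorem mem_Icc_of_lap_ne_zero {i k : ℤ} (h : lap i k ≠ 0) : k ∈ Set.Icc (i - 1) (i + 1) := by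
  unfold lap at h
  rw [Set.mem_Icc]
  split_ifs at h <;> first | omega | exact (h rfl).elim

/-- The profile `lap i + lap i'` has finite support. [cite: MochizukiEtTh2009, §1 p.240 (PDF p.14)] -/
theorem finite_lapSupport (i i' : ℤ) : {k : ℤ | lap i k + lap i' k ≠ 0}.Finite := by
  refine ((Set.finite_Icc (i - 1) (i + 1)).union (Set.finite_Icc (i' - 1) (i' + 1))).subset fun k hk => ?_
  by_contra h
  rw [Set.mem_union, not_or] at h
  have h1 : lap i k = 0 := by_contra fun h' => h.1 (mem_Icc_of_lap_ne_zero h')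
  have h2 : lap i' k = 0 := by_contra fun h' => h.2 (mem_Icc_of_lap_ne_zero h')
  exact hk (by rw [h1, h2, add_zero])

/-- **Adjacent components**: the cuspidal trace of `C_i + C_{i+1}` is supported on the FOUR cusps `i − 1, …, i + 2`
(values `1, −1, −1, 1`). [cite: MochizukiEtTh2009, Prop 5.3 proof p.327 (PDF p.101)] -/
theorem lapSupport_adjacent (i : ℤ) : {k : ℤ | lap i k + lap (i + 1) k ≠ 0} = Set.Icc (i - 1) (i + 2) := by
  ext k
  simp only [Set.mem_setOf_eq, Set.mem_Icc, lap]
  split_ifs <;> norm_num <;> omega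

/-- Hence its support has cardinality `4`. [cite: MochizukiEtTh2009, Prop 5.3 proof p.327 (PDF p.101)] -/
theorem ncard_lapSupport_adjacent (i : ℤ) : ({k : ℤ | lap i k + lap (i + 1) k ≠ 0}).ncard = 4 := by
  rw [lapSupport_adjacent, ← Finset.coe_Icc, Set.ncard_coe_finset, Int.card_Icc]
  omega

/-- **Non-adjacent components** (`i' ≥ i + 2`): the cuspidal trace of `C_i + C_{i'}` is non-zero at the FIVE distinct
cusps `i − 1, i, i + 1, i', i' + 1` (so its support has cardinality `5` or `6`, never `4`).
[cite: MochizukiEtTh2009, Prop 5.3 proof p.327 (PDF p.101)] -/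
theorem five_le_ncard_lapSupport {i i' : ℤ} (h : i + 2 ≤ i') : 5 ≤ ({k : ℤ | lap i k + lap i' k ≠ 0}).ncard := by
  have hT : (({i - 1, i, i + 1, i', i' + 1} : Finset ℤ) : Set ℤ) ⊆ {k : ℤ | lap i k + lap i' k ≠ 0} := by
    intro k hk
    simp only [Finset.coe_insert, Finset.coe_singleton, Set.mem_insert_iff, Set.mem_singleton_iff] at hk
    simp only [Set.mem_setOf_eq, lap]
    rcases hk with rfl | rfl | rfl | rfl | rfl <;> split_ifs <;> norm_num <;> omega
  have hcard : (({i - 1, i, i + 1, i', i' + 1} : Finset ℤ)).card = 5 := by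
    rw [Finset.card_insert_of_notMem, Finset.card_insert_of_notMem, Finset.card_insert_of_notMem,
      Finset.card_insert_of_notMem, Finset.card_singleton] <;> simp <;> omega
  calc 5 = (({i - 1, i, i + 1, i', i' + 1} : Finset ℤ) : Set ℤ).ncard := by rw [Set.ncard_coe_finset, hcard]
    _ ≤ _ := Set.ncard_le_ncard hT (finite_lapSupport i i')

/-- The same for `i' ≤ i − 2` (symmetry `i ↔ i'`). [cite: MochizukiEtTh2009, Prop 5.3 proof p.327 (PDF p.101)] -/
theorem five_le_ncard_lapSupport' {i i' : ℤ} (h : i' + 2 ≤ i) : 5 ≤ ({k : ℤ | lap i k + lap i' k ≠ 0}).ncard := by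
  have hset : {k : ℤ | lap i k + lap i' k ≠ 0} = {k : ℤ | lap i' k + lap i k ≠ 0} :=
    Set.ext fun k => by simp only [Set.mem_setOf_eq]; rw [add_comm]
  rw [hset]
  exact five_le_ncard_lapSupport h

/-! ### Supports of cuspidal elements, read on the cusp index -/

/-- `k ↦ Pt (inr k)` is injective. [cite: MochizukiFrdI2008, §0 p.12] -/
theorem Pt_inr_injective : Function.Injective fun k : ℤ => Pt (Sum.inr k) := by
  intro k k' h
  have := congrArg idx h
  simp only [idx_Pt, Sum.inr.injEq] at this
  exact this

/-- The support of a CUSPIDAL element is the set of cusps at which its coefficient is non-zero.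
[cite: MochizukiEtTh2009, Prop 5.3 proof p.326 (PDF p.100)] -/
theorem supp_eq_image_of_isCuspidalGp {c : GpToy} (hc : IsCuspidalGpOf' toyPrimeData toyFactor c) :
    suppOf' toyFactor c = (fun k : ℤ => Pt (Sum.inr k)) '' {k : ℤ | cf (Sum.inr k) c ≠ 0} := by
  rw [isCuspidalGpOf'_iff] at hc
  ext 𝔭
  rw [mem_suppOf'_iff]
  constructor
  · intro h
    rcases hi : idx 𝔭 with n | n
    · rw [hi] at h; exact (h (hc n)).elim
    · refine ⟨n, ?_, ?_⟩
      · rw [hi] at h; exact h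
      · change Pt (Sum.inr n) = 𝔭; rw [← hi, Pt_idx]
  · rintro ⟨k, hk, rfl⟩
    rw [idx_Pt]; exact hk

/-- Hence its cardinality is that of the index set. [cite: MochizukiEtTh2009, Prop 5.3 proof p.326 (PDF p.100)] -/
theorem ncard_supp_of_isCuspidalGp {c : GpToy} (hc : IsCuspidalGpOf' toyPrimeData toyFactor c) :
    (suppOf' toyFactor c).ncard = ({k : ℤ | cf (Sum.inr k) c ≠ 0}).ncard := by
  rw [supp_eq_image_of_isCuspidalGp hc, Set.ncard_image_of_injective _ Pt_inr_injective]


/-! ### The adjacency criterion at the toy (`hAdj`) -/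

/-- Value of the canonical component isomorphism (private twin of abc-iut-f-128's `Prop53Chain.canonIso_val`).
[cite: MochizukiEtTh2009, Prop 5.3 (ii) p.325 (PDF p.99)] -/
private theorem coe_canonIso (𝔭 𝔮 : Primes Φt) (x : ↥𝔭.submonoid) :
    ((canonIso 𝔭 𝔮 x : ↥𝔮.submonoid) : Φt) = DirectSum.single (M := Fac) (idx 𝔮) (((x : Φt) : ∀ j, Fac j) (idx 𝔭)) :=
  rfl

/-- **The binder `hAdj` of `preservesNcspLabels_of_orders` HOLDS at the toy** (with `factor := toyFactor`,
`P := toyPrincipal`) — print p.327 (PDF p.101) verbatim on the chain: for `a ∈ 𝔭 = C_i` primary and `b ∈ 𝔮 = C_{i'}` its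
image under the natural isomorphism, "`𝔭, 𝔮` are adjacent if and only if every cuspidally minimal `c ∈ Φ(A_⊚)^gp` which is
linearly equivalent to `a + b` has support of cardinality 4": the unique cuspidal element of the class of `α(C_i + C_{i'})` is
`α·(lap i + lap i')` on the cusps, of support `4` for `|i − i'| = 1` and `≥ 5` otherwise.
[cite: MochizukiEtTh2009, Prop 5.3 proof p.326–327 (PDF pp.100–101); §1 p.240 (PDF p.14)] -/
theorem adjacencyCriterion_toy :
    ∀ (𝔭 𝔮 : Primes PhiToy) (h𝔭 : ¬ toyPrimeData.IsCuspidal 𝔭) (h𝔮 : ¬ toyPrimeData.IsCuspidal 𝔮), 𝔭 ≠ 𝔮 →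
      ∀ a : 𝔭.submonoid, (a : PhiToy) ∈ 𝔭.carrier →
        (Adjacent toyPrimeData ⟨𝔭, h𝔭⟩ ⟨𝔮, h𝔮⟩ ↔
          ∀ c, IsCuspidallyMinimalOf' toyPrimeData toyFactor toyPrincipal c →
            LinEquivOf toyPrincipal c (Algebra.GrothendieckGroup.of (a : PhiToy) *
              Algebra.GrothendieckGroup.of (toyPrimeData.ncspIso 𝔭 𝔮 h𝔭 h𝔮 a : PhiToy)) →
            (suppOf' toyFactor c).ncard = 4) := by
  intro 𝔭 𝔮 h𝔭 h𝔮 hne a ha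
  obtain ⟨i, hi⟩ := idx_eq_inl_of_not_isCusp h𝔭
  obtain ⟨i', hi'⟩ := idx_eq_inl_of_not_isCusp h𝔮
  have hii' : i ≠ i' := by
    rintro rfl
    exact hne (by rw [← Pt_idx 𝔭, ← Pt_idx 𝔮, hi, hi'])
  -- the labels: `Adjacent` reads `|i − i'| = 1`
  have hAdj : Adjacent toyPrimeData ⟨𝔭, h𝔭⟩ ⟨𝔮, h𝔮⟩ ↔ |i - i'| = 1 := by
    change |label 𝔭 - label 𝔮| = 1 ↔ _
    simp [label, hi, hi']
  -- the coefficients of `E := [a] + [b]`: `α` at `C_i` and at `C_{i'}`, `0` elsewhere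
  have h𝔭P : 𝔭 = Pt (Sum.inl i) := by rw [← Pt_idx 𝔭]; exact congrArg Pt hi
  set α : ℚ := cf (Sum.inl i) (Algebra.GrothendieckGroup.of (a : PhiToy)) with hαdef
  have ha' : (a : PhiToy) ∈ (Pt (Sum.inl i)).carrier := h𝔭P ▸ ha
  have hα : 0 < α := cf_pos_of_mem_carrier ha'
  set E : GpToy := Algebra.GrothendieckGroup.of (a : PhiToy) *
    Algebra.GrothendieckGroup.of (toyPrimeData.ncspIso 𝔭 𝔮 h𝔭 h𝔮 a : PhiToy) with hE
  have hEa : ∀ m, cf m (Algebra.GrothendieckGroup.of (a : PhiToy)) = if m = Sum.inl i then α else 0 :=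
    cf_of_mem_carrier ha'
  have hEb : ∀ m, cf m (Algebra.GrothendieckGroup.of (toyPrimeData.ncspIso 𝔭 𝔮 h𝔭 h𝔮 a : PhiToy)) =
      if m = Sum.inl i' then α else 0 := by
    intro m
    change cf m (Algebra.GrothendieckGroup.of ((canonIso 𝔭 𝔮 a : ↥𝔮.submonoid) : Φt)) = _
    rw [coe_canonIso, cf_of_single, hi', hαdef, cf_of, hi]
  have hEcf : ∀ m, cf m E = (if m = Sum.inl i then α else 0) + (if m = Sum.inl i' then α else 0) := fun m => by
    rw [hE, cf_mul, hEa, hEb]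
  -- a cuspidal `c ~ E` has cusp coefficients `α·(lap i + lap i')`
  have hprof : ∀ c : GpToy, IsCuspidalGpOf' toyPrimeData toyFactor c → LinEquivOf toyPrincipal c E →
      ∀ k, cf (Sum.inr k) c = α * (lap i k + lap i' k) := by
    intro c hc hlin k
    rw [isCuspidalGpOf'_iff] at hc
    have h := (linEquivOf_toyPrincipal_iff c E).mp hlin k
    simp only [cf_mul, cf_inv, hc, hEcf, Sum.inl.injEq, reduceCtorEq, if_false] at h
    have e1 := lap_eq i k α
    have e2 := lap_eq i' k α
    linarith
  have hncard : ∀ c : GpToy, IsCuspidalGpOf' toyPrimeData toyFactor c → LinEquivOf toyPrincipal c E →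
      (suppOf' toyFactor c).ncard = ({k : ℤ | lap i k + lap i' k ≠ 0}).ncard := by
    intro c hc hlin
    rw [ncard_supp_of_isCuspidalGp hc]
    congr 1
    ext k
    simp only [Set.mem_setOf_eq, hprof c hc hlin k, mul_ne_zero_iff, hα.ne', ne_eq, not_false_eq_true, true_and]
  rw [hAdj]
  constructor
  · -- adjacent ⟹ every cuspidally minimal `c ~ E` has support of cardinality 4
    intro h1 c hcmin hlin
    rw [hncard c hcmin.1 hlin]
    rcases abs_eq (zero_le_one' ℤ) |>.mp h1 with h | h
    · have hset : {k : ℤ | lap i k + lap i' k ≠ 0} = {k : ℤ | lap i' k + lap (i' + 1) k ≠ 0} :=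
        Set.ext fun k => by simp only [Set.mem_setOf_eq]; rw [show i = i' + 1 by omega, add_comm (lap (i' + 1) k)]
      rw [hset]; exact ncard_lapSupport_adjacent i'
    · rw [show i' = i + 1 by omega]; exact ncard_lapSupport_adjacent i
  · -- not adjacent ⟹ the cuspidal element `c₀ ~ E` has support of cardinality ≥ 5
    intro h
    by_contra hna
    -- the cuspidal representative `c₀` of the class of `E`
    set α' : NNRat := Multiplicative.toAdd (Subtype.val (a : PhiToy) (Sum.inl i)) with hα'
    have hαα' : (α' : ℚ) = α := by rw [hαdef, cf_of]
    set c₀ : GpToy := Algebra.GrothendieckGroup.of (cusp (i - 1) α' * cusp (i + 1) α' * cusp (i' - 1) α' * cusp (i' + 1) α') *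
      (Algebra.GrothendieckGroup.of (cusp i (2 * α') * cusp i' (2 * α')))⁻¹ with hc₀
    have hc₀cf : ∀ m, cf m c₀ = ((if m = Sum.inr (i - 1) then α else 0) + (if m = Sum.inr (i + 1) then α else 0) +
        (if m = Sum.inr (i' - 1) then α else 0) + (if m = Sum.inr (i' + 1) then α else 0)) -
        ((if m = Sum.inr i then 2 * α else 0) + (if m = Sum.inr i' then 2 * α else 0)) := by
      intro m
      simp only [hc₀, map_mul, cf_mul, cf_inv, cf_cusp]
      push_cast
      rw [hαα']
      ring
    have hc₀c : IsCuspidalGpOf' toyPrimeData toyFactor c₀ := by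
      rw [isCuspidalGpOf'_iff]
      intro n
      rw [hc₀cf]
      simp
    have hc₀lin : LinEquivOf toyPrincipal c₀ E := by
      rw [linEquivOf_toyPrincipal_iff]
      intro k
      simp only [cf_mul, cf_inv, hc₀cf, hEcf, Sum.inl.injEq, Sum.inr.injEq, reduceCtorEq, if_false]
      have e1 := lap_eq i k α
      have e2 := lap_eq i' k α
      have e3 := lap_eq' i k α
      have e4 := lap_eq' i' k α
      linarith
    have hc₀min : IsCuspidallyMinimalOf' toyPrimeData toyFactor toyPrincipal c₀ := by
      refine ⟨hc₀c, ?_, fun y hy _ hyx => by rw [eq_of_isCuspidalGp_of_linEquiv hy hc₀c hyx]⟩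
      rw [supp_eq_image_of_isCuspidalGp hc₀c]
      refine Set.Finite.image _ ((finite_lapSupport i i').subset fun k hk => ?_)
      rw [Set.mem_setOf_eq, hprof c₀ hc₀c hc₀lin k] at hk
      exact fun h0 => hk (by rw [h0, mul_zero])
    have h4 := h c₀ hc₀min hc₀lin
    rw [hncard c₀ hc₀c hc₀lin] at h4
    rw [abs_eq (zero_le_one' ℤ)] at hna
    rcases lt_or_gt_of_ne hii' with hlt | hlt
    · have := five_le_ncard_lapSupport (i := i) (i' := i') (by omega)
      omega
    · have := five_le_ncard_lapSupport' (i := i) (i' := i') (by omega)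
      omega


/-! ### Prop. 5.3 (ii) for the chain translations of the toy -/

/-- Components of a re-indexed element (private twin of abc-iut-f-128's `Prop53Chain.reindex_apply`).
[cite: MochizukiEtTh2009, Prop 5.3 p.325 (PDF p.99)] -/
private theorem coe_reindex_apply (σ : Idx ≃ Idx) (a : Φt) (j : Idx) :
    ((reindex σ a : Φt) : ∀ j, Fac j) j = (a : ∀ j, Fac j) (σ.symm j) := rfl

/-- **Prop. 5.3 (ii) holds at the toy for the chain translations**: a re-indexing commutes with the canonical
component isomorphisms (both read off one coefficient). [cite: MochizukiEtTh2009, Prop 5.3 (ii) p.325 (PDF p.99)] -/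
theorem preservesNcspComponentIsos_shift (t : ℤ) :
    PreservesNcspComponentIsos toyPrimeData (CategoryTheory.Equivalence.refl : TC ≌ TC) (Iso.refl Q)
      (reindex (shift t)) (cuspPreserved_shift t) := by
  intro p q hp hq _ x
  change reindex (shift t) ((canonIso p q x : ↥q.submonoid) : Φt) =
    ((canonIso (Primes.congr (reindex (shift t)) p) (Primes.congr (reindex (shift t)) q)
      (Primes.submonoidCongr (reindex (shift t)) p _ rfl x) : ↥(Primes.congr (reindex (shift t)) q).submonoid) : Φt)
  rw [coe_canonIso, coe_canonIso, reindex_single, idx_congr_reindex, idx_congr_reindex,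
    Primes.coe_submonoidCongr_apply, coe_reindex_apply, Equiv.symm_apply_apply]

/-! ### The certificate for (v) -/

/-- **NON-VACUITY of the binders of `preservesNcspLabels_of_orders` (row F-0563)** at the perfect toy `Φ(A_⊚)`, for every
chain translation `e = reindex (shift t)`: `factor := toyFactor`, `P := toyPrincipal` satisfy `hψo`, `hP`, `hAdj`
simultaneously, and (ii) holds (with `hc := cuspPreserved_shift t`). [cite: MochizukiEtTh2009, Prop 5.3 proof p.327 (PDF p.101)] -/
theorem adjacency_binders_toy (t : ℤ) :
    ∃ (factor : PhiToy →* (Primes PhiToy → Multiplicative ℚ)) (P : Subgroup GpToy),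
      (∀ (𝔭 : Primes PhiToy) (a : PhiToy),
        ordOf' factor (Primes.congr (psiToy (shift t)) 𝔭) (psiToy (shift t) a) = ordOf' factor 𝔭 a) ∧
      (∀ x, ThetaFrobenioid.gpMap (psiToy (shift t)).toMonoidHom x ∈ P ↔ x ∈ P) ∧
      PreservesNcspComponentIsos toyPrimeData (CategoryTheory.Equivalence.refl : TC ≌ TC) (Iso.refl Q)
        (reindex (shift t)) (cuspPreserved_shift t) ∧
      (∀ (𝔭 𝔮 : Primes PhiToy) (h𝔭 : ¬ toyPrimeData.IsCuspidal 𝔭) (h𝔮 : ¬ toyPrimeData.IsCuspidal 𝔮), 𝔭 ≠ 𝔮 →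
        ∀ a : 𝔭.submonoid, (a : PhiToy) ∈ 𝔭.carrier →
          (Adjacent toyPrimeData ⟨𝔭, h𝔭⟩ ⟨𝔮, h𝔮⟩ ↔
            ∀ c, IsCuspidallyMinimalOf' toyPrimeData factor P c →
              LinEquivOf P c (Algebra.GrothendieckGroup.of (a : PhiToy) *
                Algebra.GrothendieckGroup.of (toyPrimeData.ncspIso 𝔭 𝔮 h𝔭 h𝔮 a : PhiToy)) →
              (suppOf' factor c).ncard = 4)) :=
  ⟨toyFactor, toyPrincipal, ordMap_toy (shift t), gpMap_psiToy_shift_mem_toyPrincipal_iff t,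
    preservesNcspComponentIsos_shift t, adjacencyCriterion_toy⟩

/-- **[EtTh] Prop. 5.3 (v) AT THE TOY, derived THROUGH the order-coordinate instance form** `preservesNcspLabels_of_orders`
(row F-0563; abc-iut-f-128, p438690) with every binder discharged — the form is not vacuous.
[cite: MochizukiEtTh2009, Prop 5.3 (v) p.325 (PDF p.99); proof p.327 (PDF p.101)] -/
theorem preservesNcspLabels_shift_viaOrders (t : ℤ) :
    PreservesNcspLabels toyPrimeData (CategoryTheory.Equivalence.refl : TC ≌ TC) (Iso.refl Q) (reindex (shift t))
      (cuspPreserved_shift t) :=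
  preservesNcspLabels_of_orders toyPrimeData _ _ _ toyFactor toyPrincipal (cuspPreserved_shift t)
    (preservesNcspComponentIsos_shift t) (ordMap_toy (shift t)) (gpMap_psiToy_shift_mem_toyPrincipal_iff t)
    adjacencyCriterion_toy

end Prop53Toy

end FrobenioidThetaDivisors

end Literature.AnabelianGeometry.EtaleTheta
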